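import Summits.AtomisticToContinuum.Crystallization.Theorems.FrustratedLawDichotomyStrainedPatchRecutLevelGap
import Summits.AtomisticToContinuum.Crystallization.Theorems.FrustratedLawDichotomyStrainedPatchWindowTaylorTail

/-!
# LEAST SQUARES ON THE CHART SIDE: (R1) moved to the ∃ side (ROOMᴸ), the `Q`-threaded seams, and the ♭ record `coreOff_record_g55b`

**FILE SPLIT (gate 400-line cap, hand-2 g27 landing edit; statements and proofs byte-identical):** this file `…RecutLSA` = PART A of lens-5 g54's `…RecutLS` fb7a54c51c84db0a (everything up to and including `exists_chart_recut_at`); PART B is `…RecutLS`, which imports this file and continues the SAME namespace `…Theorems.FrustratedLawDichotomyStrainedPatchRecutLS` (all fully-qualified names unchanged).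
# (27623 strained-patch piece, T-side [CORE-FAR]; decomp-a2c lens-5 «RecutPairs», generation 54 → 55)

(Imports `…RecutLevelGap` and the tree's `…WindowTaylorTail` (for `taylorTwoBentW_holds`).)

THE OBSERVATION.  In the record `coreOff_record_g54W_T2` the only binder quantifying over ALL charts of the family with a claim about the least-squares matrix
is (RFᴿ) — through its core (R1) `‖A_LS‖ ≤ κL₀·t` — and the level-0 seam `edgeFar_of_familyRecutCap` feeds (F1ᴿ-cap) ONE chart only: (F2)'s chart of the
rotated cluster at `t = T₀(z₀)`.  A small bound on `A_LS` is FALSE as a ∀-chart claim (a pure homogeneous-strain offset chart is a valid `ChartBy` chart and has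
`‖A_LS‖/t = 1/6.3`; mixtures with box modes reach `0.29`; census KAPPAL28: sup `0.3915 < κL₀ = 2/5`, margin 2 %), but it is CHEAP on (F2)'s own chart (census
LSW28: realised `‖A_LS‖/t ≤ 0.139` on admissible rays).  So (R1) belongs on the ∃ side.

THE MOVE.  Least squares is formulated on the CHART side (§1): `LSAt A …` = the normal equations of the `A`-corrected deviation `dev₀ − A·x₀` against the recut
design `(1+A)x₀` on the uncapped annulus; `LSNear κ … t := ∃ A, ‖A‖ ≤ κ·max t 0 ∧ LSAt A …`.  ★ `projectedFree_of_recutOf`: for a centre-keeping recut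
`RecutOf A` the chart-side normal equations ARE `projectedFree` of the recut (the recut relabels every uncapped site by `(1+A)`, `recutOf_label`; `dev₁ = dev₀ − A x₀`;
the residual clause with `u := dev₀`, `L := A(1+A)⁻¹`).  A cluster–chart predicate `Q` is threaded through exactly THREE binders (§2): `AffineRecutQ Q` (RF only for
`Q`-charts), `FamilyEnvelopeRecutCapQ Q`, `FamilyRoomQ Q` (ROOM's chart satisfies `Q`); the level-2 `Paired*` binders, (DOMᴿ) and (F3ᴿ) are UNCHANGED in shape.
The seams re-prove verbatim (`familyEnvelopeRecutCapQ_of_pieces`, `edgeFar_of_familyRecutCapQ`, `coreOff_of_familyRecutCapQ_of_band_of_soft`).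

THE THEOREMS (§3).  ★★★ `affineRecutQ_of_good`: for `0 ≤ κ ≤ κ♭₀ := 3/20`, (R7ᴸ)_κ `RecutGoodWith 𝓘₀ᴿʷˢ κ` (the good window of the recut centre) ⟹
`AffineRecutQ (LSNear κ) 𝓘₀ᴿʷˢ 𝓘₁ʷ 𝓑₀ τ₀ τ₁ κN₁ κ T₀` with the ORIGINAL level constant `κN₁ = 1/3` (`levelNear_kN1_of_recutOf`: at `‖A‖ ≤ κt ≤ 1/400` the transport
gives `(2 + 2·0.07)·κ/(1 − 2κt) ≤ 0.3226 ≤ 1/3`; chart-side columns `ShellGap (1/20)`, `nn ≤ 7/5` of `𝓘₀ᴿʷᴳ`) — so the tree's `Phi1` tables stay; and ★★★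
`recutGoodWith_of_le`: (R7ᴸ)_κ ITSELF is a theorem for `κ ≤ 3/20` (image level `(1/16 + (2 + 1/16)α)/(1−α) ≤ 0.0678 ≤ 7/100` at `α ≤ 1/400`), hence ★★★★
`recutLSG_holds : RecutLSG` — the recut/refit binder (RF) of the g53/g54 records is DISCHARGED COMPLETELY at the small radius.

THE ♭ RECORD (§4, pins `kLb = 3/20`).  ★★★★ `coreOff_record_g55b (BASᴳ) (MEMᴳ μ) (LINᴳ Ψ) (DOMᴳ (Ψ+ϱ₀+μ)) (ROOMᴸ) (F3ᴳ) [BRIDGE] [SOFT-FAR] : [CORE-FAR]`: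
(RFᴿ) is GONE (the theorem `recutLSG_holds`); (T2) is the tree theorem `taylorTwoBentW_holds`; every TABLE / ANALYTIC binder is the `g54W` binder RESTRICTED to the
smaller family `𝓘₀ᴿʷˢ` and the smaller recut ball `κ♭₀ = 3/20 < κL₀ = 2/5` (`basinRBentG_of_W`, …, `familyCertRBentG_of_W`: each is IMPLIED by its `g54W`
counterpart); the one STRENGTHENED binder is (ROOMᴸ) `FamilyRoomLSG` = (F2ᴿ-bentW0) on `𝓘₀ᴿʷˢ` + «the room chart is `κ♭₀·T₀`-LS-near» (∃-side; census LSW28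
`0.139 ≤ 0.15`, KAPPA-ADM owed).  Budget effect (census H0COL28/BUDGET54 bookkeeping): the worst-case recut allowance `‖dS/dA‖_F·κL·T₀` scales by `κ♭₀/κL₀ = 3/8`.
No sorry, no new axioms, no cite tokens, no instances / notation.  `--supports stmt-AtomisticToContinuum-27623`.
-/

noncomputable section

namespace Summit.AtomisticToContinuum.Crystallization.Theorems.FrustratedLawDichotomyStrainedPatchRecutLS

open scoped BigOperators Classical
open Summit.AtomisticToContinuum.Crystallization.Theorems.FrustratedLawDichotomyPeriodicBlockFlags (goodAtScale_mono)
open Summit.AtomisticToContinuum.Crystallization.Theorems.FrustratedLawDichotomyRangeCut (Sep)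
open Summit.AtomisticToContinuum.Crystallization.Theorems.FrustratedLawDichotomyMotifLemmas
open Summit.AtomisticToContinuum.Crystallization.Theorems.FrustratedLawDichotomyAveragingCut
open Summit.AtomisticToContinuum.Crystallization.Theorems.FrustratedLawDichotomyAveragingRuleCap
open Summit.AtomisticToContinuum.Crystallization.Theorems.FrustratedLawDichotomyAveragingRuleTightFree
open Summit.AtomisticToContinuum.Crystallization.Theorems.FrustratedLawDichotomyExemptDoor (SitePred)
open Summit.AtomisticToContinuum.Crystallization.Theorems.FrustratedLawDichotomyExemptAbsorption
open Summit.AtomisticToContinuum.Crystallization.Theorems.FrustratedLawDichotomyExemptAbsorptionRecord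
open Summit.AtomisticToContinuum.Crystallization.Theorems.FrustratedLawDichotomyCollarCensus
open Summit.AtomisticToContinuum.Crystallization.Theorems.FrustratedLawDichotomyCollarCensusKappa
open Summit.AtomisticToContinuum.Crystallization.Theorems.FrustratedLawDichotomyStrainedPatchHomSplit
open Summit.AtomisticToContinuum.Crystallization.Theorems.FrustratedLawDichotomyStrainedPatchCleanCollar
open Summit.AtomisticToContinuum.Crystallization.Theorems.FrustratedLawDichotomyStrainedPatchHomTube
open Summit.AtomisticToContinuum.Crystallization.Theorems.FrustratedLawDichotomyStrainedPatchHomIsometry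
open Summit.AtomisticToContinuum.Crystallization.Theorems.FrustratedLawDichotomyStrainedPatchHomTubeIso
open Summit.AtomisticToContinuum.Crystallization.Theorems.FrustratedLawDichotomyStrainedPatchPhaseCut
open Summit.AtomisticToContinuum.Crystallization.Theorems.FrustratedLawDichotomyStrainedPatchCoreTube
open Summit.AtomisticToContinuum.Crystallization.Theorems.FrustratedLawDichotomyStrainedPatchCoreTubeRecord
open Summit.AtomisticToContinuum.Crystallization.Theorems.FrustratedLawDichotomyStrainedPatchCoreTubeMilli
open Summit.AtomisticToContinuum.Crystallization.Theorems.FrustratedLawDichotomyStrainedPatchStrainBands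
open Summit.AtomisticToContinuum.Crystallization.Theorems.FrustratedLawDichotomyStrainedPatchChartFamilies
open Summit.AtomisticToContinuum.Crystallization.Theorems.FrustratedLawDichotomyStrainedPatchChartFamiliesBent
open Summit.AtomisticToContinuum.Crystallization.Theorems.FrustratedLawDichotomyStrainedPatchChartFamiliesPinned
open Summit.AtomisticToContinuum.Crystallization.Theorems.FrustratedLawDichotomyStrainedPatchEnvelopeLaw
open Summit.AtomisticToContinuum.Crystallization.Theorems.FrustratedLawDichotomyStrainedPatchEnvelopeTaylor
open Literature.Barriers.AtomisticToContinuum.FlatleyTheil2015 (fccVec)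
open Summit.AtomisticToContinuum.Crystallization.Theorems.FrustratedLawDichotomyStrainedPatchRecutPairs
open Summit.AtomisticToContinuum.Crystallization.Theorems.FrustratedLawDichotomyStrainedPatchRecutKinematics
open Literature.Barriers.AtomisticToContinuum.FlatleyTheil2015 (fccPoint)
open Summit.AtomisticToContinuum.Crystallization.Theorems.FrustratedLawDichotomyStrainedPatchHomRelief (latPt_fccVec_eq)
open Summit.AtomisticToContinuum.Crystallization.Theorems.FrustratedLawDichotomyStrainedPatchHomLatticeBox (norm_apply_ge_of_near_one latPt_zero
  mem_box_of_norm_fccPoint_lt)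
open Summit.AtomisticToContinuum.Crystallization.Theorems.FrustratedLawDichotomyStrainedPatchHomLatticeBoxHcp (latPt_eq_apply_one shifted_eq_apply)
open Summit.AtomisticToContinuum.Crystallization.Theorems.FrustratedLawDichotomyStrainedPatchHomLatticeBoxWindow (mem_box_of_norm_hexPt_lt'
  mem_box_of_norm_hexPt_add_shift_lt')
open Summit.AtomisticToContinuum.Crystallization.Theorems.FrustratedLawDichotomyStrainedPatchWindowFamilies
open Summit.AtomisticToContinuum.Crystallization.Theorems.FrustratedLawDichotomyStrainedPatchRecutBuild
open Summit.AtomisticToContinuum.Crystallization.Theorems.FrustratedLawDichotomyStrainedPatchRecutRecord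
open Summit.AtomisticToContinuum.Crystallization.Theorems.FrustratedLawDichotomyStrainedPatchRecutChart
open Literature.Geometry.DiscreteGeometry (nearestDist nearestDist_le_dist le_nearestDist exists_nearestDist_eq_dist nearestDist_nonneg
  fccKissingPattern hcpKissingPattern card_fccKissingPattern card_hcpKissingPattern norm_eq_one_of_mem_fccKissingPattern norm_eq_one_of_mem_hcpKissingPattern)
open Summit.AtomisticToContinuum.Crystallization.Theorems.FrustratedLawDichotomyStrainedPatchRecutLevel
open Summit.AtomisticToContinuum.Crystallization.Theorems.FrustratedLawDichotomyStrainedPatchRecutLevelGap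
open Summit.AtomisticToContinuum.Crystallization.Theorems.FrustratedLawDichotomyStrainedPatchWindowTaylorTail (taylorTwoBentW_holds)

/-! ## §1. Least squares on the chart side and its transport to the recut -/

/-- The `A`-CORRECTED DEVIATION of a chart: `devA A … a = dev₀ a − A (z₀ (e₀ a) − z₀ c₀)` (= the deviation of the `A`-recut at the same site, `dev_recut`). -/
def devA (A : E3 →L[ℝ] E3) {M : ℕ} (z : Fin M → E3) (c : Fin M) {M₀ : ℕ} (z₀ : Fin M₀ → E3) (c₀ : Fin M₀) (e₀ : Fin M → Fin M₀) (a : Fin M) : E3 :=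
  dev z c z₀ c₀ e₀ a - A (z₀ (e₀ a) - z₀ c₀)

/-- **`LSAt A M z c M₀ z₀ c₀ e₀`** [chart-side normal equations] — on the uncapped annulus the `A`-corrected deviation is orthogonal (entrywise second moments) to
the recut design `(1+A)(z₀ (e₀ a) − z₀ c₀)`: `A` is THE least-squares linear part of the chart's deviation field (in the recut parametrisation). -/
def LSAt (A : E3 →L[ℝ] E3) (M : ℕ) (z : Fin M → E3) (c : Fin M) (M₀ : ℕ) (z₀ : Fin M₀ → E3) (c₀ : Fin M₀) (e₀ : Fin M → Fin M₀) : Prop :=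
  ∀ i j : Fin 3, ∑ a ∈ uncapped z c, devA A z c z₀ c₀ e₀ a i * (((1 : E3 →L[ℝ] E3) + A) (z₀ (e₀ a) - z₀ c₀)) j = 0

/-- **`LSNear κ M z c M₀ z₀ c₀ e₀ t`** [cluster–chart predicate · INSTRUMENTABLE (census LSW28: realised `‖A_LS‖/t ≤ 0.139`)] — the chart's least-squares matrix
is `κ·t`-small: `∃ A, ‖A‖ ≤ κ·max t 0 ∧ LSAt A …`. -/
def LSNear (κ : ℝ) (M : ℕ) (z : Fin M → E3) (c : Fin M) (M₀ : ℕ) (z₀ : Fin M₀ → E3) (c₀ : Fin M₀) (e₀ : Fin M → Fin M₀) (t : ℝ) : Prop :=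
  ∃ A : E3 →L[ℝ] E3, ‖A‖ ≤ κ * max t 0 ∧ LSAt A M z c M₀ z₀ c₀ e₀

/-- `LSNear` is monotone in `κ`. [formal bookkeeping] -/
theorem LSNear.mono {κ κ' : ℝ} (hle : κ ≤ κ') {M : ℕ} {z : Fin M → E3} {c : Fin M} {M₀ : ℕ} {z₀ : Fin M₀ → E3} {c₀ : Fin M₀} {e₀ : Fin M → Fin M₀} {t : ℝ}
    (h : LSNear κ M z c M₀ z₀ c₀ e₀ t) : LSNear κ' M z c M₀ z₀ c₀ e₀ t := by
  obtain ⟨A, hA, hLS⟩ := h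
  exact ⟨A, hA.trans (mul_le_mul_of_nonneg_right hle (le_max_right _ _)), hLS⟩

/-- An uncapped site of a `ChartBy 𝓘 τ t` chart has chart vector of norm `≤ 63/10 + τ` and deviation of norm `≤ t`. [formal bookkeeping] -/
theorem chartBy_uncapped {𝓘 : (M₀ : ℕ) → (Fin M₀ → E3) → Fin M₀ → Prop} {τ t : ℝ} {M : ℕ} {z : Fin M → E3} {c : Fin M} {M₀ : ℕ} {z₀ : Fin M₀ → E3}
    {c₀ : Fin M₀} {e : Fin M → Fin M₀} (hch : ChartBy 𝓘 τ t z c z₀ c₀ e) {a : Fin M} (ha : a ∈ uncapped z c) :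
    ‖z₀ (e a) - z₀ c₀‖ ≤ 63 / 10 + τ ∧ ‖dev z c z₀ c₀ e a‖ ≤ t := by
  obtain ⟨-, -, hcoarse, hfine, -, -⟩ := hch
  simp only [uncapped, Finset.mem_filter, mem_ball] at ha
  obtain ⟨hac, hcap⟩ := ha
  have h1 := hcoarse a hac
  have h2 := hfine a hac (fun j hj => hcap j hj)
  rw [dist_eq_norm] at h1 h2
  refine ⟨?_, h2⟩
  have hp : ‖z a - z c‖ ≤ 63 / 10 := by rw [← dist_eq_norm]; exact hac
  calc ‖z₀ (e a) - z₀ c₀‖ = ‖(z a - z c) - ((z a - z c) - (z₀ (e a) - z₀ c₀))‖ := by rw [sub_sub_cancel]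
    _ ≤ ‖z a - z c‖ + ‖(z a - z c) - (z₀ (e a) - z₀ c₀)‖ := norm_sub_le _ _
    _ ≤ 63 / 10 + τ := by linarith

/-- ★ **THE RECUT RELABELS BY `(1+A)`** — for `RecutOf A z₀ c₀ z₁ c₁ e₀ e₁` (`‖A‖ ≤ 1/150`) and a site whose chart vector has norm `≤ 131/20` (every ball site of a
coarse-`1/4` chart): `z₁ (e₁ a) − z₁ c₁ = (1+A)(z₀ (e₀ a) − z₀ c₀)` (window book-keeping: skeleton norm `≤ 131/20 + 21/10`, image norm `≤ 133/10`). [folklore] -/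
theorem recutOf_label {A : E3 →L[ℝ] E3} {M₀ : ℕ} {z₀ : Fin M₀ → E3} {c₀ : Fin M₀} {M₁ : ℕ} {z₁ : Fin M₁ → E3} {c₁ : Fin M₁} {M : ℕ} {e₀ : Fin M → Fin M₀}
    {e₁ : Fin M → Fin M₁} (h : RecutOf A z₀ c₀ z₁ c₁ e₀ e₁) (hA : ‖A‖ ≤ 1 / 150) {a : Fin M} (ha : ‖z₀ (e₀ a) - z₀ c₀‖ ≤ 131 / 20) :
    z₁ (e₁ a) - z₁ c₁ = ((1 : E3 →L[ℝ] E3) + A) (z₀ (e₀ a) - z₀ c₀) := by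
  obtain ⟨φ, b₀, b₁, G, ξ, s, w, hb₀, -, hs, hzs, hconj, -, hwr, -, hz₁, he₁⟩ := h
  have hσ : s (e₀ a) - s c₀ ∈ latSet φ G ξ ∧ ‖s (e₀ a) - s c₀‖ ≤ 133 / 10 := by
    have hk : s (e₀ a) ∈ homRange φ G ξ (133 / 10) (s c₀) := hs ▸ ⟨e₀ a, rfl⟩
    rw [mem_homRange_iff, dist_eq_norm] at hk
    exact ⟨hk.2, hk.1⟩
  have hb : ‖b₀ (s (e₀ a) - s c₀)‖ ≤ 131 / 20 := by rw [← hzs]; exact ha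
  have hmem : ((1 : E3 →L[ℝ] E3) + A) (s (e₀ a) - s c₀) ∈ Set.range w := by
    rw [hwr]
    refine ⟨?_, ?_⟩
    · rw [latSet_mul]; exact ⟨s (e₀ a) - s c₀, hσ.1, rfl⟩
    · have hb' := norm_le_of_bends0_window hb₀ hσ.2
      have h1 := norm_one_add_apply_le A hA (s (e₀ a) - s c₀)
      have h0 : 0 ≤ ‖s (e₀ a) - s c₀‖ := norm_nonneg _
      show ‖((1 : E3 →L[ℝ] E3) + A) (s (e₀ a) - s c₀)‖ ≤ 133 / 10
      nlinarith
  obtain ⟨j, hj⟩ := hmem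
  have hdiff₁ : z₁ (e₁ a) - z₁ c₁ = b₁ (w (e₁ a)) := by rw [hz₁ (e₁ a), add_sub_cancel_left]
  rw [hdiff₁, he₁ a, apply_idxOf c₁ ⟨j, hj⟩, hconj, hzs]

/-- ★★ **THE CHART-SIDE NORMAL EQUATIONS ARE `projectedFree` OF THE RECUT** — for a recut `RecutOf A z₀ c₀ z₁ c₁ e₀ e₁` (`‖A‖ ≤ 1/150`) of a chart whose uncapped
sites have chart vectors of norm `≤ 131/20` and deviations of norm `≤ t` (any `ChartBy 𝓘 (1/4) t` chart) and `LSAt A …`: `projectedFree M z c M₁ z₁ c₁ e₁ t`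
(`dev₁ = dev₀ − A x₀ = devA A …` on the annulus by `recutOf_label` + `dev_recut`; residual clause with `u := dev₀`, `L := A ∘ (1+A)⁻¹`). [folklore] -/
theorem projectedFree_of_recutOf {A : E3 →L[ℝ] E3} {M₀ : ℕ} {z₀ : Fin M₀ → E3} {c₀ : Fin M₀} {M₁ : ℕ} {z₁ : Fin M₁ → E3} {c₁ : Fin M₁} {M : ℕ}
    {e₀ : Fin M → Fin M₀} {e₁ : Fin M → Fin M₁} (h : RecutOf A z₀ c₀ z₁ c₁ e₀ e₁) (hA : ‖A‖ ≤ 1 / 150) {z : Fin M → E3} {c : Fin M} {t : ℝ}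
    (hcoarse : ∀ a ∈ uncapped z c, ‖z₀ (e₀ a) - z₀ c₀‖ ≤ 131 / 20) (hfine : ∀ a ∈ uncapped z c, ‖dev z c z₀ c₀ e₀ a‖ ≤ t)
    (hLS : LSAt A M z c M₀ z₀ c₀ e₀) : projectedFree M z c M₁ z₁ c₁ e₁ t := by
  have hlab : ∀ a ∈ uncapped z c, z₁ (e₁ a) - z₁ c₁ = ((1 : E3 →L[ℝ] E3) + A) (z₀ (e₀ a) - z₀ c₀) :=
    fun a ha => recutOf_label h hA (hcoarse a ha)
  have hdev : ∀ a ∈ uncapped z c, dev z c z₁ c₁ e₁ a = dev z c z₀ c₀ e₀ a - A (z₀ (e₀ a) - z₀ c₀) :=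
    fun a ha => dev_recut z c z₀ c₀ e₀ z₁ c₁ e₁ A (hlab a ha)
  refine ⟨fun i j => ?_, ?_⟩
  · have h0 := hLS i j
    simp only [devA] at h0
    exact (Finset.sum_congr rfl (fun a ha => by rw [hdev a ha, hlab a ha])).trans h0
  · obtain ⟨A', -, hinv, -⟩ := exists_inv_one_add A hA (by norm_num)
    refine ⟨((A.comp (((1 : E3 →L[ℝ] E3) + A'))) : E3 →L[ℝ] E3), dev z c z₀ c₀ e₀, hfine, fun a ha => ?_⟩
    rw [hdev a ha, hlab a ha]
    simp only [ContinuousLinearMap.coe_coe, ContinuousLinearMap.coe_comp, Function.comp_apply, hinv]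

/-! ## §2. The `Q`-threaded binders and seams (level 1, level 0, the node to [CORE-FAR]) -/

/-- **(RFᴿ)_Q `AffineRecutQ Q 𝓘₀ 𝓘₁ 𝓑₀ τ₀ τ₁ κN κL T`** [KINEMATIC] — (RFᴿ) `AffineRecut` demanded only for charts satisfying the cluster–chart predicate `Q … t`. -/
def AffineRecutQ (Q : (M : ℕ) → (Fin M → E3) → Fin M → (M₀ : ℕ) → (Fin M₀ → E3) → Fin M₀ → (Fin M → Fin M₀) → ℝ → Prop)
    (𝓘₀ 𝓘₁ : (M₀ : ℕ) → (Fin M₀ → E3) → Fin M₀ → Prop) (𝓑₀ : Set (E3 → E3)) (τ₀ τ₁ κN κL : ℝ) (T : (M₀ : ℕ) → (Fin M₀ → E3) → Fin M₀ → ℝ) : Prop :=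
  ∀ (M : ℕ) (z : Fin M → E3) (c : Fin M) (M₀ : ℕ) (z₀ : Fin M₀ → E3) (c₀ : Fin M₀) (e₀ : Fin M → Fin M₀) (t : ℝ),
    Admissible M z c → CleanBall (63 / 10) z c → MonoPhaseBall (63 / 10) z c → 0 ≤ t → t ≤ T M₀ z₀ c₀ → ChartBy 𝓘₀ τ₀ t z c z₀ c₀ e₀ →
      Q M z c M₀ z₀ c₀ e₀ t →
        ∃ (M₁ : ℕ) (z₁ : Fin M₁ → E3) (c₁ : Fin M₁) (e₁ : Fin M → Fin M₁),
          LevelNear κN t z₀ c₀ z₁ c₁ ∧ RecutNear 𝓑₀ κL t z₀ c₀ z₁ c₁ ∧ ChartBy 𝓘₁ τ₁ τ₁ z c z₁ c₁ e₁ ∧ projectedFree M z c M₁ z₁ c₁ e₁ t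

/-- (RFᴿ) ⟹ (RFᴿ)_Q for every `Q`. [formal bookkeeping] -/
theorem affineRecutQ_of_affineRecut {Q : (M : ℕ) → (Fin M → E3) → Fin M → (M₀ : ℕ) → (Fin M₀ → E3) → Fin M₀ → (Fin M → Fin M₀) → ℝ → Prop}
    {𝓘₀ 𝓘₁ : (M₀ : ℕ) → (Fin M₀ → E3) → Fin M₀ → Prop} {𝓑₀ : Set (E3 → E3)} {τ₀ τ₁ κN κL : ℝ} {T : (M₀ : ℕ) → (Fin M₀ → E3) → Fin M₀ → ℝ}
    (h : AffineRecut 𝓘₀ 𝓘₁ 𝓑₀ τ₀ τ₁ κN κL T) : AffineRecutQ Q 𝓘₀ 𝓘₁ 𝓑₀ τ₀ τ₁ κN κL T :=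
  fun M z c M₀ z₀ c₀ e₀ t hz hcl hm ht htT hch _ => h M z c M₀ z₀ c₀ e₀ t hz hcl hm ht htT hch

/-- **(F1ᴿ-cap)_Q `FamilyEnvelopeRecutCapQ Q 𝓘₀ 𝓘₁ 𝓑₀ τ₀ κN κL Φ T`** [ANALYTIC] — (F1ᴿ-cap) for charts satisfying `Q … t`. -/
def FamilyEnvelopeRecutCapQ (Q : (M : ℕ) → (Fin M → E3) → Fin M → (M₀ : ℕ) → (Fin M₀ → E3) → Fin M₀ → (Fin M → Fin M₀) → ℝ → Prop)
    (𝓘₀ 𝓘₁ : (M₀ : ℕ) → (Fin M₀ → E3) → Fin M₀ → Prop) (𝓑₀ : Set (E3 → E3)) (τ₀ κN κL : ℝ) (Φ : (M₀ : ℕ) → (Fin M₀ → E3) → Fin M₀ → ℝ → ℝ)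
    (T : (M₀ : ℕ) → (Fin M₀ → E3) → Fin M₀ → ℝ) : Prop :=
  ∀ (M : ℕ) (z : Fin M → E3) (c : Fin M) (M₀ : ℕ) (z₀ : Fin M₀ → E3) (c₀ : Fin M₀) (e₀ : Fin M → Fin M₀) (t : ℝ),
    Admissible M z c → CleanBall (63 / 10) z c → MonoPhaseBall (63 / 10) z c → 0 ≤ t → t ≤ T M₀ z₀ c₀ → ChartBy 𝓘₀ τ₀ t z c z₀ c₀ e₀ →
      Q M z c M₀ z₀ c₀ e₀ t →
        ∃ (M₁ : ℕ) (z₁ : Fin M₁ → E3) (c₁ : Fin M₁), 𝓘₁ M₁ z₁ c₁ ∧ LevelNear κN t z₀ c₀ z₁ c₁ ∧ RecutNear 𝓑₀ κL t z₀ c₀ z₁ c₁ ∧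
          ballAvg (9 / 5) z₁ (xRec M₁ z₁) c₁ - Φ M₀ z₀ c₀ t ≤ ballAvg (9 / 5) z (xRec M z) c

/-- **(F2)_Q `FamilyRoomQ Q 𝓘 ρ ε η₂ τ T`** [(F2) `FamilyRoom` + the room chart satisfies `Q` at `t = T(z₀)` · ∃-side] — every admissible clean mono-phase
`¬NearHomIsoAt ρ ε`, `η₂`-good cluster is, after a rotation, charted (coarse `τ`, fine `T(z₀) ≥ 0`) by an instance of `𝓘` with `Q` holding for that chart. -/
def FamilyRoomQ (Q : (M : ℕ) → (Fin M → E3) → Fin M → (M₀ : ℕ) → (Fin M₀ → E3) → Fin M₀ → (Fin M → Fin M₀) → ℝ → Prop)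
    (𝓘 : (M₀ : ℕ) → (Fin M₀ → E3) → Fin M₀ → Prop) (ρ ε η₂ τ : ℝ) (T : (M₀ : ℕ) → (Fin M₀ → E3) → Fin M₀ → ℝ) : Prop :=
  ∀ (M : ℕ) (z : Fin M → E3) (c : Fin M), Admissible M z c → CleanBall (63 / 10) z c → MonoPhaseBall (63 / 10) z c → ¬NearHomIsoAt ρ ε z c →
    GoodAtScale η₂ (3 / 2) z c →
      ∃ (R : E3 ≃ₗᵢ[ℝ] E3) (M₀ : ℕ) (z₀ : Fin M₀ → E3) (c₀ : Fin M₀) (e : Fin M → Fin M₀),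
        0 ≤ T M₀ z₀ c₀ ∧ ChartBy 𝓘 τ (T M₀ z₀ c₀) (⇑R ∘ z) c z₀ c₀ e ∧ Q M (⇑R ∘ z) c M₀ z₀ c₀ e (T M₀ z₀ c₀)

/-- (F2)_Q ⟹ (F2) (forget `Q`). [formal bookkeeping] -/
theorem familyRoom_of_familyRoomQ {Q : (M : ℕ) → (Fin M → E3) → Fin M → (M₀ : ℕ) → (Fin M₀ → E3) → Fin M₀ → (Fin M → Fin M₀) → ℝ → Prop}
    {𝓘 : (M₀ : ℕ) → (Fin M₀ → E3) → Fin M₀ → Prop} {ρ ε η₂ τ : ℝ} {T : (M₀ : ℕ) → (Fin M₀ → E3) → Fin M₀ → ℝ} (h : FamilyRoomQ Q 𝓘 ρ ε η₂ τ T) :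
    FamilyRoom 𝓘 ρ ε η₂ τ T := by
  intro M z c hz hcl hm hn hg
  obtain ⟨R, M₀, z₀, c₀, e, ht, hch, -⟩ := h M z c hz hcl hm hn hg
  exact ⟨R, M₀, z₀, c₀, e, ht, hch⟩

/-- ★★ THE `Q`-THREADED LEVEL-1 SEAM: (RFᴿ)_Q ∧ (ENVᴿ_projectedFree) ∧ (DOMᴿ) ⟹ (F1ᴿ-cap)_Q.  One `linarith`. [folklore] -/
theorem familyEnvelopeRecutCapQ_of_pieces {Q : (M : ℕ) → (Fin M → E3) → Fin M → (M₀ : ℕ) → (Fin M₀ → E3) → Fin M₀ → (Fin M → Fin M₀) → ℝ → Prop}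
    {𝓘₀ 𝓘₁ : (M₀ : ℕ) → (Fin M₀ → E3) → Fin M₀ → Prop} {𝓑₀ : Set (E3 → E3)} {τ₀ τ₁ κN κL : ℝ} {T : (M₀ : ℕ) → (Fin M₀ → E3) → Fin M₀ → ℝ}
    {Ψ Φ : (M₀ : ℕ) → (Fin M₀ → E3) → Fin M₀ → ℝ → ℝ} (hRF : AffineRecutQ Q 𝓘₀ 𝓘₁ 𝓑₀ τ₀ τ₁ κN κL T)
    (hE : PairedEnvelopeOn projectedFree 𝓘₀ 𝓘₁ 𝓑₀ τ₀ τ₁ κL T Ψ) (hD : RecutDomination 𝓘₀ 𝓘₁ 𝓑₀ κN κL T Ψ Φ) :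
    FamilyEnvelopeRecutCapQ Q 𝓘₀ 𝓘₁ 𝓑₀ τ₀ κN κL Φ T := by
  intro M z c M₀ z₀ c₀ e₀ t hz hcl hm ht htT hch hQ
  obtain ⟨M₁, z₁, c₁, e₁, hN, hRN, hch₁, hP⟩ := hRF M z c M₀ z₀ c₀ e₀ t hz hcl hm ht htT hch hQ
  have h₁ := hE M z c M₀ z₀ c₀ e₀ M₁ z₁ c₁ e₁ t hz hcl hm ht htT ⟨hch, hRN, hch₁⟩ hP
  have h₂ := hD M₀ z₀ c₀ M₁ z₁ c₁ t hch.1 hch₁.1 ht htT hN hRN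
  exact ⟨M₁, z₁, c₁, hch₁.1, hN, hRN, by linarith⟩

/-- ★★ THE `Q`-THREADED LEVEL-0 SEAM: (F1ᴿ-cap)_Q ∧ (F2)_Q ∧ (F3ᴿ) ⟹ `EdgeFarFloor (63/10) (63/10) ρ ε η₂ φ` ((F2)_Q's chart of the rotated cluster at `t = T(z₀)`
satisfies `Q`, so (F1ᴿ-cap)_Q applies to it; (F3ᴿ) prices the recut; the score is rotation invariant). [folklore] -/
theorem edgeFar_of_familyRecutCapQ {Q : (M : ℕ) → (Fin M → E3) → Fin M → (M₀ : ℕ) → (Fin M₀ → E3) → Fin M₀ → (Fin M → Fin M₀) → ℝ → Prop}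
    {𝓘₀ 𝓘₁ : (M₀ : ℕ) → (Fin M₀ → E3) → Fin M₀ → Prop} {𝓑₀ : Set (E3 → E3)} {ρ ε η₂ τ₀ κN κL φ : ℝ} {Φ : (M₀ : ℕ) → (Fin M₀ → E3) → Fin M₀ → ℝ → ℝ}
    {T : (M₀ : ℕ) → (Fin M₀ → E3) → Fin M₀ → ℝ} (hE : FamilyEnvelopeRecutCapQ Q 𝓘₀ 𝓘₁ 𝓑₀ τ₀ κN κL Φ T) (hR : FamilyRoomQ Q 𝓘₀ ρ ε η₂ τ₀ T)
    (hC : FamilyCertRecut 𝓘₀ 𝓘₁ 𝓑₀ κN κL φ Φ T) : EdgeFarFloor (63 / 10) (63 / 10) ρ ε η₂ φ := by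
  intro M z c hz hcl hm hn hg
  obtain ⟨R, M₀, z₀, c₀, e, ht, hch, hQ⟩ := hR M z c hz hcl hm hn hg
  obtain ⟨M₁, z₁, c₁, hI₁, hN, hRN, h₁⟩ := hE M (⇑R ∘ z) c M₀ z₀ c₀ e _ ((admissible_comp_iff R z c).2 hz) ((cleanBall_comp_iff R z c).2 hcl)
    ((monoPhaseBall_comp_iff R z c).2 hm) ht le_rfl hch hQ
  rw [ballAvg_xRec_comp] at h₁
  have h₃ := hC M₀ z₀ c₀ M₁ z₁ c₁ hch.1 hI₁ hN hRN
  linarith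

/-- ★★ THE `Q`-THREADED NODE TO [CORE-FAR]: (F1ᴿ-cap)_Q ∧ (F2)_Q ∧ (F3ᴿ) ∧ [BRIDGE] ∧ [SOFT-FAR] ⟹ `CoreOffTubeFloor (63/10) (63/10) ρ ε φ`. [folklore] -/
theorem coreOff_of_familyRecutCapQ_of_band_of_soft
    {Q : (M : ℕ) → (Fin M → E3) → Fin M → (M₀ : ℕ) → (Fin M₀ → E3) → Fin M₀ → (Fin M → Fin M₀) → ℝ → Prop}
    {𝓘₀ 𝓘₁ : (M₀ : ℕ) → (Fin M₀ → E3) → Fin M₀ → Prop} {𝓑₀ : Set (E3 → E3)} {ρ ε ηE η₂ τ₀ κN κL φ : ℝ} {Φ : (M₀ : ℕ) → (Fin M₀ → E3) → Fin M₀ → ℝ → ℝ}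
    {T : (M₀ : ℕ) → (Fin M₀ → E3) → Fin M₀ → ℝ} (hE : FamilyEnvelopeRecutCapQ Q 𝓘₀ 𝓘₁ 𝓑₀ τ₀ κN κL Φ T) (hR : FamilyRoomQ Q 𝓘₀ ρ ε ηE τ₀ T)
    (hC : FamilyCertRecut 𝓘₀ 𝓘₁ 𝓑₀ κN κL φ Φ T) (hB : BandFarFloor (63 / 10) (63 / 10) ρ ε ηE η₂ φ) (hS : SoftFarFloor (63 / 10) (63 / 10) ρ ε η₂ φ) :
    CoreOffTubeFloor (63 / 10) (63 / 10) ρ ε φ :=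
  coreOff_of_edge_of_band_of_soft (edgeFar_of_familyRecutCapQ hE hR hC) hB hS

/-- A paired chart is MONOTONE in the chart family and in the recut radius `κL`. [formal bookkeeping] -/
theorem pairedChart_mono {𝓘₀ 𝓘₀' 𝓘₁ : (M₀ : ℕ) → (Fin M₀ → E3) → Fin M₀ → Prop} (hle : FamilyLE 𝓘₀ 𝓘₀') {𝓑₀ : Set (E3 → E3)} {τ₀ τ₁ κL κL' t : ℝ}
    (hκ : κL ≤ κL') {M : ℕ} {z : Fin M → E3} {c : Fin M} {M₀ : ℕ} {z₀ : Fin M₀ → E3} {c₀ : Fin M₀} {e₀ : Fin M → Fin M₀} {M₁ : ℕ} {z₁ : Fin M₁ → E3}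
    {c₁ : Fin M₁} {e₁ : Fin M → Fin M₁} (h : PairedChart 𝓘₀ 𝓘₁ 𝓑₀ τ₀ τ₁ κL t z c z₀ c₀ e₀ z₁ c₁ e₁) :
    PairedChart 𝓘₀' 𝓘₁ 𝓑₀ τ₀ τ₁ κL' t z c z₀ c₀ e₀ z₁ c₁ e₁ :=
  ⟨h.1.mono_family hle, h.2.1.mono hκ, h.2.2⟩

/-- (BASᴿ) is ANTITONE in the chart family and in `κL`. [formal bookkeeping] -/
theorem pairedBasin_anti {P : (M : ℕ) → (Fin M → E3) → Fin M → (M₁ : ℕ) → (Fin M₁ → E3) → Fin M₁ → (Fin M → Fin M₁) → ℝ → Prop}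
    {𝓘₀ 𝓘₀' 𝓘₁ : (M₀ : ℕ) → (Fin M₀ → E3) → Fin M₀ → Prop} (hle : FamilyLE 𝓘₀ 𝓘₀') {𝓑₀ : Set (E3 → E3)} {τ₀ τ₁ κL κL' δ : ℝ} (hκ : κL ≤ κL')
    {T : (M₀ : ℕ) → (Fin M₀ → E3) → Fin M₀ → ℝ} (h : PairedBasin P 𝓘₀' 𝓘₁ 𝓑₀ τ₀ τ₁ κL' T δ) : PairedBasin P 𝓘₀ 𝓘₁ 𝓑₀ τ₀ τ₁ κL T δ :=
  fun M z c M₀ z₀ c₀ e₀ M₁ z₁ c₁ e₁ t hz hcl hm ht htT hpc hP => h M z c M₀ z₀ c₀ e₀ M₁ z₁ c₁ e₁ t hz hcl hm ht htT (pairedChart_mono hle hκ hpc) hP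

/-- (MEMᴿ) is ANTITONE in the chart family and in `κL`. [formal bookkeeping] -/
theorem pairedMembership_anti {𝓘₀ 𝓘₀' 𝓘₁ : (M₀ : ℕ) → (Fin M₀ → E3) → Fin M₀ → Prop} (hle : FamilyLE 𝓘₀ 𝓘₀') {𝓑₀ : Set (E3 → E3)}
    {τ₀ τ₁ κL κL' δ : ℝ} (hκ : κL ≤ κL') {T : (M₀ : ℕ) → (Fin M₀ → E3) → Fin M₀ → ℝ} {μ : (M₁ : ℕ) → (Fin M₁ → E3) → Fin M₁ → ℝ}
    (h : PairedMembership 𝓘₀' 𝓘₁ 𝓑₀ τ₀ τ₁ κL' T δ μ) : PairedMembership 𝓘₀ 𝓘₁ 𝓑₀ τ₀ τ₁ κL T δ μ :=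
  fun M z c M₀ z₀ c₀ e₀ M₁ z₁ c₁ e₁ t hz hcl ht htT hpc hF => h M z c M₀ z₀ c₀ e₀ M₁ z₁ c₁ e₁ t hz hcl ht htT (pairedChart_mono hle hκ hpc) hF

/-- (LINᴿ) is ANTITONE in the chart family and in `κL`. [formal bookkeeping] -/
theorem pairedSlaved_anti {P : (M : ℕ) → (Fin M → E3) → Fin M → (M₁ : ℕ) → (Fin M₁ → E3) → Fin M₁ → (Fin M → Fin M₁) → ℝ → Prop}
    {𝓘₀ 𝓘₀' 𝓘₁ : (M₀ : ℕ) → (Fin M₀ → E3) → Fin M₀ → Prop} (hle : FamilyLE 𝓘₀ 𝓘₀') {𝓑₀ : Set (E3 → E3)} {τ₀ τ₁ κL κL' δ : ℝ} (hκ : κL ≤ κL')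
    {T : (M₀ : ℕ) → (Fin M₀ → E3) → Fin M₀ → ℝ} {G : (M₁ : ℕ) → (Fin M₁ → E3) → Fin M₁ → Fin M₁ → (E3 →L[ℝ] ℝ)}
    {w : (M₁ : ℕ) → (Fin M₁ → E3) → Fin M₁ → Fin M₁ → Fin M₁ → ℝ} {Ψ : (M₁ : ℕ) → (Fin M₁ → E3) → Fin M₁ → ℝ → ℝ}
    (h : PairedSlaved P 𝓘₀' 𝓘₁ 𝓑₀ τ₀ τ₁ κL' T δ G w Ψ) : PairedSlaved P 𝓘₀ 𝓘₁ 𝓑₀ τ₀ τ₁ κL T δ G w Ψ :=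
  fun M z c M₀ z₀ c₀ e₀ M₁ z₁ c₁ e₁ t hz hcl hm ht htT hpc hP hF =>
    h M z c M₀ z₀ c₀ e₀ M₁ z₁ c₁ e₁ t hz hcl hm ht htT (pairedChart_mono hle hκ hpc) hP hF

/-- (DOMᴿ) is ANTITONE in the chart family and in `κL`. [formal bookkeeping] -/
theorem recutDomination_anti {𝓘₀ 𝓘₀' 𝓘₁ : (M₀ : ℕ) → (Fin M₀ → E3) → Fin M₀ → Prop} (hle : FamilyLE 𝓘₀ 𝓘₀') {𝓑₀ : Set (E3 → E3)} {κN κL κL' : ℝ}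
    (hκ : κL ≤ κL') {T : (M₀ : ℕ) → (Fin M₀ → E3) → Fin M₀ → ℝ} {Ψ Φ : (M₀ : ℕ) → (Fin M₀ → E3) → Fin M₀ → ℝ → ℝ}
    (h : RecutDomination 𝓘₀' 𝓘₁ 𝓑₀ κN κL' T Ψ Φ) : RecutDomination 𝓘₀ 𝓘₁ 𝓑₀ κN κL T Ψ Φ :=
  fun M₀ z₀ c₀ M₁ z₁ c₁ t hI₀ hI₁ ht htT hN hRN => h M₀ z₀ c₀ M₁ z₁ c₁ t (hle M₀ z₀ c₀ hI₀) hI₁ ht htT hN (hRN.mono hκ)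

/-- (F3ᴿ) is ANTITONE in the chart family and in `κL`. [formal bookkeeping] -/
theorem familyCertRecut_anti {𝓘₀ 𝓘₀' 𝓘₁ : (M₀ : ℕ) → (Fin M₀ → E3) → Fin M₀ → Prop} (hle : FamilyLE 𝓘₀ 𝓘₀') {𝓑₀ : Set (E3 → E3)} {κN κL κL' φ : ℝ}
    (hκ : κL ≤ κL') {Φ : (M₀ : ℕ) → (Fin M₀ → E3) → Fin M₀ → ℝ → ℝ} {T : (M₀ : ℕ) → (Fin M₀ → E3) → Fin M₀ → ℝ}
    (h : FamilyCertRecut 𝓘₀' 𝓘₁ 𝓑₀ κN κL' φ Φ T) : FamilyCertRecut 𝓘₀ 𝓘₁ 𝓑₀ κN κL φ Φ T :=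
  fun M₀ z₀ c₀ M₁ z₁ c₁ hI₀ hI₁ hN hRN => h M₀ z₀ c₀ M₁ z₁ c₁ (hle M₀ z₀ c₀ hI₀) hI₁ hN (hRN.mono hκ)

/-! ## §3. (RFᴿ)_LSNear from the good window alone: the recut at radius `κ ≤ 3/20` is `κN₁ = 1/3`-level-near -/

/-- ★ **`ChartFamilyRWS` = `𝓘₀ᴿʷˢ`** [DESIGNATE chart family of the ♭ record] — the recut-pair chart family `𝓘₀ᴿʷ` with the SMALL shell-gap column `ShellGap (1/50) z₀ c₀`
(empty annulus `(1.28·nn, 1.32·nn)`; census SHELLGAP27 (B): min `g(13/10) = 0.0251 ≥ 1/50` over the typed homogeneous box incl. the fcc uniaxial `−8 %` corner, so the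
column COVERS the box at the fixed pivot `13/10` — unlike `ShellGap (1/20)` of `𝓘₀ᴿʷᴳ`, which the small radius makes unnecessary) and `nearestDist z₀ c₀ ≤ 7/5`. -/
def ChartFamilyRWS : (M₀ : ℕ) → (Fin M₀ → E3) → Fin M₀ → Prop :=
  fun M₀ z₀ c₀ => ChartFamilyRW M₀ z₀ c₀ ∧ ShellGap (1 / 50) z₀ c₀ ∧ nearestDist z₀ c₀ ≤ 7 / 5

/-- `𝓘₀ᴿʷˢ ≤ 𝓘₀ᴿʷ`. [formal bookkeeping] -/
theorem chartFamilyRWS_le : FamilyLE ChartFamilyRWS ChartFamilyRW := fun _ _ _ h => h.1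

/-- `𝓘₀ᴿʷᴳ ≤ 𝓘₀ᴿʷˢ` (a `1/20`-gap is a `1/50`-gap). [formal bookkeeping] -/
theorem chartFamilyRWG_le_RWS : FamilyLE ChartFamilyRWG ChartFamilyRWS := fun _ _ _ h => ⟨h.1, h.2.1.mono (by norm_num), h.2.2⟩

/-- ★ Every `𝓘₀ᴿʷ`-charted cluster is charted by THE recut of the chart by any `A` with `‖A‖ ≤ κ·max t 0`, `κ ≤ κL₀` — `exists_chart_recut_of_chartFamilyRW` with the
`RecutNear` clause at radius `κ` (same terms; `recutNear_recut` is generic in the radius). [folklore] -/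
theorem exists_chart_recut_at {M : ℕ} {z : Fin M → E3} {c : Fin M} {M₀ : ℕ} {z₀ : Fin M₀ → E3} {c₀ : Fin M₀} {e₀ : Fin M → Fin M₀} {t κ : ℝ}
    (hch : ChartBy ChartFamilyRW tau0 t z c z₀ c₀ e₀) (ht : 0 ≤ t) (ht' : t ≤ T0 M₀ z₀ c₀) (A : E3 →L[ℝ] E3) (hA : ‖A‖ ≤ κ * max t 0) (hκ : κ ≤ kL0)
    (y : E3) :
    ∃ (M₁ : ℕ) (z₁ : Fin M₁ → E3) (c₁ : Fin M₁) (e₁ : Fin M → Fin M₁), RecutOf A z₀ c₀ z₁ c₁ e₀ e₁ ∧ z₁ c₁ = y ∧ RecutNear bends0 κ t z₀ c₀ z₁ c₁ ∧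
      Function.Injective z₁ ∧ Sep z₁ ∧ IsBentBall bends1 (133 / 10) z₁ c₁ ∧ (GoodAtScale eta30 (3 / 2) z₁ c₁ → ChartBy CompFamilyW tau1 tau1 z c z₁ c₁ e₁) := by
  have hI : ChartFamilyRW M₀ z₀ c₀ := hch.1
  have hinj₀ : Function.Injective z₀ := hI.1.1.1
  obtain ⟨φ, b₀, G, ξ, hb₀, hP₀, hG, hξ, hW⟩ := hI.2
  have ht60 : t ≤ 1 / 60 := ht'.trans (T0_le_of_goodAtScale hI.1.2.2)
  have hAk : ‖A‖ ≤ kL0 * max t 0 := hA.trans (mul_le_mul_of_nonneg_right hκ (le_max_right _ _))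
  have hA' : ‖A‖ ≤ 1 / 150 := hAk.trans (kL0_mul_le ht ht60)
  obtain ⟨b₁, M₁, w, c₁, hb₁, hconj, hwinj, hwr, hwc, hP₁, hbent, hinj₁, hsep⟩ :=
    exists_recut hb₀ hG (hξ.trans (by norm_num [xi0])) (by simpa only [sep0] using hW) A hA' y
  have hb₁0 : b₁ 0 = 0 := polyBend_zero (q₂ := 11 / 2000) (q₃ := 11 / 20000) (by simpa [bends1] using hb₁)
  obtain ⟨-, -, s, hs, hzs⟩ := hP₀
  have hy : (fun j => y + b₁ (w j)) c₁ = y := by simp only [hwc, hb₁0, add_zero]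
  refine ⟨M₁, fun j => y + b₁ (w j), c₁, fun a => idxOf w c₁ (((1 : E3 →L[ℝ] E3) + A) (s (e₀ a) - s c₀)),
    ⟨φ, b₀, b₁, G, ξ, s, w, hb₀, hb₁, hs, hzs, hconj, hwinj, hwr, hwc, fun j => by rw [hy], fun a => rfl⟩, hy,
    recutNear_recut hb₀ ⟨?_, ?_, s, hs, hzs⟩ hA hconj hP₁, hinj₁, hsep, hbent, fun hgood => ?_⟩
  · exact hG.trans (by norm_num [beta0])
  · exact hξ.trans (by norm_num [xi0])
  · exact chartBy_recut hch hinj₀ hb₀ hs hzs A hA' hb₁0 hconj hwinj hwr hwc y (compFamilyW_recut hinj₁ hsep hbent hgood)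

end Summit.AtomisticToContinuum.Crystallization.Theorems.FrustratedLawDichotomyStrainedPatchRecutLS
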